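import Summits.BirchSwinnertonDyer.Rank1Residual.X5.SelmerSolitaireQuadratic
import HarnessLib

/-!
# X5 · Selmer solitaire, quadratic layer — Q5: the INDUCED CUBE (QS4 `inducedCube_holds`,
# QS4′ `inducedCube'_holds`): cube-adjacent core vertices are `𝒳⁰`-adjacent

HONEST FRAMING (cell `b2b-bsdres`, run/shared/lean/b2b/bsd-rank1-residual/, verbatim in every
file): the goal of the cell is to DELETE the COMBINATION-SHAPED residual classes of the
Birch–Swinnerton-Dyer formula for ALL analytic-rank `≤ 1` elliptic curves over `ℚ` — "full BSD
formula for every rank `≤ 1` curve in class `C`" assembled STRICTLY from published theorems — so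
that the rank-`≤ 1` remainder becomes exactly the CONSTRUCTION-SHAPED classes, which are TYPED
(missing-input `Prop`s), NOT attempted. This is not "finishing BSD". O1 team (class X5, `p = 2`,
non-CM), ORDER v2.9 pool slot (ii‴) = lens-2 GEN 10's QUADRATIC-SPACE LAYER (o1 lead R-G20.3 /
R-G20.4, PLAN C150), item **Q5**; pool hand = seat `b2b-bsdres-x11b3-p3` GEN 8 (x11b3 prover released
to the o1 pool; yields to x11b3 deals). PURE `𝔽₂` LINEAR ALGEBRA about the vocabulary of
`X5/SelmerSolitaireQuadratic.lean` (x11b3-p4, p283641; spelling of record = lens-2's seat sketch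
`HOME/b2b-bsdres-o1-idea-2-g10/lean/O1Stub1QuadraticSketch.lean`): THEOREMS ONLY (no definition, no
named fact, no `sorry`); nothing arithmetic is asserted (the dictionary AR1–AR4 to Selmer groups is
NOT here); reach-neutral (R1 closes no class); nothing booked; O1 OPEN.

## What is proved (`U` a totally `Q_D`-singular Lagrangian, `n ⊆ D`, `ℓ ∉ n`)

The word-shapes QS4 `InducedCube` and QS4′ `InducedCube'` of Q1, VERBATIM, as the theorems
`inducedCube_holds` and `inducedCube'_holds` (reserved names, o1 lead R-G20.3): if `n` and `n ∪ {ℓ}`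
are both CORE (`U ∩ Λ*_n = 0 = U ∩ Λ*_{n ∪ ℓ}`) then the generator `c_n` of `U ∩ Λ_n` has
`u_ℓ`-coordinate `1` and the generator `c_{n ∪ ℓ}` of `U ∩ Λ_{n ∪ ℓ}` has `t_ℓ`-coordinate `1` — so the
cube edge `{n, n ∪ ℓ}` IS an edge of Mazur–Rubin's graph `𝒳⁰` (both localisation maps at `ℓ` are
isomorphisms; `CubeAdj` of `X5/SelmerSolitaire` is the `𝒳⁰` relation). Road = lens-2 GEN 5's T2
proof "directly via `dim P̄₂ = 2`" (NOT via the parity law QS3, so Q7 is not a prerequisite), in four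
steps (namespace `…Quadratic.Cube`):

* §1 `qform` on vectors with one vanishing coordinate at every finite vertex (`Λ_n`-type support):
  `q(x) = x_∞.1 · x_∞.2`; with the vertex `ℓ` relaxed: `q(x) = x_∞.1 · x_∞.2 + x_ℓ.1 · x_ℓ.2`.
* §2 LINE LEMMA `Cube.eq_of_inLam`: at a core vertex `m`, two non-zero elements of `U ∩ Λ_m` are
  EQUAL (their `∞`-parts are non-zero singular vectors of the hyperbolic plane `P̄₂`, i.e. `w` or
  `w′`; equal `∞`-parts ⇒ the difference lies in `U ∩ Λ*_m = 0`; different ones ⇒ the sum has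
  `∞`-part `w + w′` with `q = 1`, contradicting total singularity). In particular `U ∩ Λ_m` is a
  line — this is where `dim P̄₂ = 2` enters.
* §3 RANK–NULLITY `Cube.exists_relaxed`: the elements of `U` satisfying the `Λ_n`-conditions at the
  vertices `≠ ℓ` form a subspace of dimension `≥ (s + 1) − (s − 1) = 2`, hence contain a vector
  `y ∉ {0, x}` for any given `x`.
* §4 MAIN LEMMA `Cube.eq_zero_of_inLam_of_inLam_insert`: for `ℓ ∉ n` with `n`, `n ∪ ℓ` core,
  `U ∩ Λ_n ∩ Λ_{n ∪ ℓ} = 0` — given `x ≠ 0` there and `y` from §3, the four values of `y_ℓ ∈ 𝔽₂²`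
  are all absurd: `(0,0)`, `(1,0)` put `y` in `Λ_n`, `(0,1)` puts it in `Λ_{n∪ℓ}` (so `y = x` by §2,
  but `y ≠ x` resp. `x_ℓ = 0`), and `(1,1)` forces `y_∞ = w + w′` by `q(y) = 0`, whence
  `q(x + y) = 1`. §5: QS4 / QS4′ follow, since a vanishing `u_ℓ`- (resp. `t_ℓ`-) coordinate would
  put the generator in both `Λ_n` and `Λ_{n ∪ ℓ}`.

Executable evidence (lens-2 GEN 10, EVIDENCE only): `qs_layer_check.py`, 768 / 768 adjacent core
pairs at `|D| = 3`.

References: lens-2 GEN 5 (G5.3 T2) and GEN 10 (2G10.2 QS4/QS4′, 2G10.6 Q5), `cells/o1/ROUTES-O1.md`;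
B. Mazur, K. Rubin, *Introduction to Kolyvagin systems*, Contemp. Math. 358 (2004), Def. 4.2 and §5
(the graph `𝒳⁰`) [cite: MazurRubin2004Intro, §5]; B. Poonen, E. Rains, JAMS 25 (2012) §4 (the
quadratic spaces) [cite: PoonenRains2012, §4]. Folklore linear algebra over `𝔽₂`.

## Tree search (dedup, 2026-08-21)
`lean search 'inducedCube|Quadratic.Cube|InducedCube'` → only Q1's word-shapes; INBOX grep
'QuadraticInducedCube' → 2G10.6 and this hand's INTENT (l.5236). Q1 / Q3-lemmas consumed BY NAME
(`InducedCube`, `InducedCube'`, `IsTSLagrangian`, `CoreQ`, `InLam`, `InLamStar`, `qform`); imports Q1 only.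
-/

namespace Summit.BirchSwinnertonDyer.Rank1Residual.X5.SelmerSolitaire.Quadratic

open Finset SelmerSolitaire

namespace Cube

variable {s : ℕ}

/-! ### §1 `qform` on `Λ`-type vectors -/

/-- If every finite vertex carries a vanishing coordinate product, `q(x)` is the `∞`-term
`x_∞.1 · x_∞.2`. [folklore] -/
theorem qform_eq_apply_none {x : QVec s} (h : ∀ i : Fin s, (x (some i)).1 * (x (some i)).2 = 0) :
    qform x = (x none).1 * (x none).2 := by
  unfold qform
  rw [Fintype.sum_option, Finset.sum_eq_zero fun i _ ↦ h i, add_zero]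

/-- A vector of `Λ_n` has a vanishing coordinate (hence coordinate product) at every finite vertex.
[cite: MazurRubin2004Intro, Def. 4.2] -/
theorem fst_mul_snd_eq_zero_of_inLam {n : Finset (Fin s)} {x : QVec s} (hx : InLam n x)
    (i : Fin s) : (x (some i)).1 * (x (some i)).2 = 0 := by
  by_cases hi : i ∈ n
  · rw [(hx i).1 hi, zero_mul]
  · rw [(hx i).2 hi, mul_zero]

/-- On `Λ_n`, `q(x) = x_∞.1 · x_∞.2` (only the plane `P̄₂` contributes). [cite: PoonenRains2012, §4] -/
theorem qform_eq_of_inLam {n : Finset (Fin s)} {x : QVec s} (hx : InLam n x) :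
    qform x = (x none).1 * (x none).2 :=
  qform_eq_apply_none (fst_mul_snd_eq_zero_of_inLam hx)

/-- `Λ_n` is closed under addition. [folklore] -/
theorem inLam_add {n : Finset (Fin s)} {x y : QVec s} (hx : InLam n x) (hy : InLam n y) :
    InLam n (x + y) := fun i ↦
  ⟨fun hi ↦ by rw [Pi.add_apply, Prod.fst_add, (hx i).1 hi, (hy i).1 hi, add_zero],
   fun hi ↦ by rw [Pi.add_apply, Prod.snd_add, (hx i).2 hi, (hy i).2 hi, add_zero]⟩

/-- `Λ_n` is closed under subtraction. [folklore] -/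
theorem inLam_sub {n : Finset (Fin s)} {x y : QVec s} (hx : InLam n x) (hy : InLam n y) :
    InLam n (x - y) := fun i ↦
  ⟨fun hi ↦ by rw [Pi.sub_apply, Prod.fst_sub, (hx i).1 hi, (hy i).1 hi, sub_zero],
   fun hi ↦ by rw [Pi.sub_apply, Prod.snd_sub, (hx i).2 hi, (hy i).2 hi, sub_zero]⟩

/-- With the vertex `ℓ` relaxed (the `Λ_n`-conditions imposed only at the vertices `≠ ℓ`),
`q(x) = x_∞.1 · x_∞.2 + x_ℓ.1 · x_ℓ.2`. [folklore] -/
theorem qform_eq_of_relaxed {n : Finset (Fin s)} {l : Fin s} {x : QVec s}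
    (hx : ∀ i : Fin s, i ≠ l → (i ∈ n → (x (some i)).1 = 0) ∧ (i ∉ n → (x (some i)).2 = 0)) :
    qform x = (x none).1 * (x none).2 + (x (some l)).1 * (x (some l)).2 := by
  unfold qform
  rw [Fintype.sum_option, Finset.sum_eq_single l (fun i _ hi ↦ ?_) (fun h ↦ absurd (mem_univ l) h)]
  by_cases hin : i ∈ n
  · rw [(hx i hi).1 hin, zero_mul]
  · rw [(hx i hi).2 hin, mul_zero]

/-- A vector of `Λ_n` satisfies the relaxed conditions. [folklore] -/
theorem relaxed_of_inLam {n : Finset (Fin s)} (l : Fin s) {x : QVec s} (hx : InLam n x) :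
    ∀ i : Fin s, i ≠ l → (i ∈ n → (x (some i)).1 = 0) ∧ (i ∉ n → (x (some i)).2 = 0) :=
  fun i _ ↦ hx i

/-- Relaxed conditions + vanishing `t_ℓ`-coordinate ⇒ `x ∈ Λ_n` (for `ℓ ∉ n`). [folklore] -/
theorem inLam_of_relaxed {n : Finset (Fin s)} {l : Fin s} (hl : l ∉ n) {x : QVec s}
    (hx : ∀ i : Fin s, i ≠ l → (i ∈ n → (x (some i)).1 = 0) ∧ (i ∉ n → (x (some i)).2 = 0))
    (h2 : (x (some l)).2 = 0) : InLam n x := by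
  intro i
  by_cases hi : i = l
  · subst hi
    exact ⟨fun h ↦ absurd h hl, fun _ ↦ h2⟩
  · exact hx i hi

/-- Relaxed conditions + vanishing `u_ℓ`-coordinate ⇒ `x ∈ Λ_{n ∪ ℓ}`. [folklore] -/
theorem inLam_insert_of_relaxed {n : Finset (Fin s)} {l : Fin s} {x : QVec s}
    (hx : ∀ i : Fin s, i ≠ l → (i ∈ n → (x (some i)).1 = 0) ∧ (i ∉ n → (x (some i)).2 = 0))
    (h1 : (x (some l)).1 = 0) : InLam (insert l n) x := by
  intro i
  by_cases hi : i = l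
  · subst hi
    exact ⟨fun _ ↦ h1, fun h ↦ absurd (mem_insert_self i n) h⟩
  · refine ⟨fun h ↦ ?_, fun h ↦ ?_⟩
    · exact (hx i hi).1 ((mem_insert.mp h).resolve_left hi)
    · exact (hx i hi).2 fun h' ↦ h (mem_insert_of_mem h')

/-- `x ∈ Λ_n` with vanishing `u_ℓ`-coordinate lies in `Λ_{n ∪ ℓ}`. [folklore] -/
theorem inLam_insert_of_inLam {n : Finset (Fin s)} (l : Fin s) {x : QVec s} (hx : InLam n x)
    (h1 : (x (some l)).1 = 0) : InLam (insert l n) x :=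
  inLam_insert_of_relaxed (relaxed_of_inLam l hx) h1

/-- `x ∈ Λ_{n ∪ ℓ}` (`ℓ ∉ n`) with vanishing `t_ℓ`-coordinate lies in `Λ_n`. [folklore] -/
theorem inLam_of_inLam_insert {n : Finset (Fin s)} {l : Fin s} (hl : l ∉ n) {x : QVec s}
    (hx : InLam (insert l n) x) (h2 : (x (some l)).2 = 0) : InLam n x := by
  refine inLam_of_relaxed hl (fun i hi ↦ ⟨fun h ↦ ?_, fun h ↦ ?_⟩) h2
  · exact (hx i).1 (mem_insert_of_mem h)
  · exact (hx i).2 fun h' ↦ ((mem_insert.mp h').elim hi h)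

/-! ### §2 The line lemma at a core vertex (`dim P̄₂ = 2`) -/

/-- At a core vertex `n`, a non-zero element of `U ∩ Λ_n` has non-zero `∞`-part (else it would lie in
`U ∩ Λ*_n = 0`). [cite: MazurRubin2004Intro, Def. 4.2] -/
theorem apply_none_ne_zero {U : Submodule (ZMod 2) (QVec s)} {n : Finset (Fin s)} (hn : CoreQ U n)
    {x : QVec s} (hx : x ∈ U) (hxn : InLam n x) (hx0 : x ≠ 0) : x none ≠ 0 :=
  fun h ↦ hx0 (hn x hx ⟨h, hxn⟩)

/-- The `𝔽₂²` bookkeeping of the hyperbolic plane `P̄₂`: two NON-ZERO singular vectors (`a.1·a.2 = 0`)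
whose sum is again singular are equal (the singular vectors are `w = (1,0)` and `w′ = (0,1)`, and
`w + w′ = (1,1)` is anisotropic). [folklore] -/
theorem eq_of_singular_of_add_singular :
    ∀ a b : ZMod 2 × ZMod 2, a ≠ 0 → b ≠ 0 → a.1 * a.2 = 0 → b.1 * b.2 = 0 →
      (a + b).1 * (a + b).2 = 0 → a = b := by
  decide

/-- **LINE LEMMA.** In a totally singular `U`, at a CORE vertex `n`, two non-zero elements of
`U ∩ Λ_n` are equal: `U ∩ Λ_n` is a line whose generator has `∞`-part `w` or `w′` (lens-2 G5.3, the
`dim P̄₂ = 2` step of T1/T2). Proof: their `∞`-parts are non-zero (core) singular vectors (`q = 0` and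
§1), and so is the `∞`-part of the sum; hence the `∞`-parts agree, and the difference lies in
`U ∩ Λ*_n = 0`. [cite: MazurRubin2004Intro, Def. 4.2] -/
theorem eq_of_inLam {U : Submodule (ZMod 2) (QVec s)} (hq : ∀ x ∈ U, qform x = 0)
    {n : Finset (Fin s)} (hn : CoreQ U n) {x y : QVec s} (hx : x ∈ U) (hy : y ∈ U)
    (hxn : InLam n x) (hyn : InLam n y) (hx0 : x ≠ 0) (hy0 : y ≠ 0) : x = y := by
  have hqx : (x none).1 * (x none).2 = 0 := by rw [← qform_eq_of_inLam hxn]; exact hq x hx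
  have hqy : (y none).1 * (y none).2 = 0 := by rw [← qform_eq_of_inLam hyn]; exact hq y hy
  have hqxy : ((x + y) none).1 * ((x + y) none).2 = 0 := by
    rw [← qform_eq_of_inLam (inLam_add hxn hyn)]; exact hq _ (U.add_mem hx hy)
  have hxy : x none = y none :=
    eq_of_singular_of_add_singular _ _ (apply_none_ne_zero hn hx hxn hx0)
      (apply_none_ne_zero hn hy hyn hy0) hqx hqy hqxy
  have hsub : x - y = 0 :=
    hn (x - y) (U.sub_mem hx hy) ⟨by rw [Pi.sub_apply, hxy, sub_self], inLam_sub hxn hyn⟩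
  exact sub_eq_zero.mp hsub

/-! ### §3 Rank–nullity: a second vector with the vertex `ℓ` relaxed -/

/-- **Two independent directions with `ℓ` relaxed.** If `dim U = s + 1`, then for every `n`, `ℓ` and
every vector `x` there is `y ∈ U`, `y ≠ 0`, `y ≠ x`, satisfying the `Λ_n`-conditions at all vertices
`≠ ℓ`: these conditions are `s − 1` linear equations on `U`, so their solution space has dimension
`≥ 2` (rank–nullity) and is not contained in the line through `x`. [folklore] -/
theorem exists_relaxed {U : Submodule (ZMod 2) (QVec s)} (hU : Module.finrank (ZMod 2) U = s + 1)
    (n : Finset (Fin s)) (l : Fin s) (x : QVec s) :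
    ∃ y ∈ U, y ≠ 0 ∧ y ≠ x ∧
      ∀ i : Fin s, i ≠ l → (i ∈ n → (y (some i)).1 = 0) ∧ (i ∉ n → (y (some i)).2 = 0) := by
  classical
  -- the `s - 1` "forbidden coordinates" off `ℓ`, as a linear map
  obtain ⟨φ, hφ⟩ : ∃ φ : QVec s →ₗ[ZMod 2] ({i : Fin s // i ≠ l} → ZMod 2), ∀ y i,
      φ y i = if (i : Fin s) ∈ n then (y (some (i : Fin s))).1 else (y (some (i : Fin s))).2 :=
    ⟨{ toFun := fun y i ↦ if (i : Fin s) ∈ n then (y (some (i : Fin s))).1 else (y (some (i : Fin s))).2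
       map_add' := fun y y' ↦ by
         funext i
         simp only [Pi.add_apply, Prod.fst_add, Prod.snd_add]
         split_ifs <;> rfl
       map_smul' := fun c y ↦ by
         funext i
         simp only [Pi.smul_apply, Prod.smul_fst, Prod.smul_snd, smul_eq_mul, RingHom.id_apply]
         split_ifs <;> rfl }, fun _ _ ↦ rfl⟩
  -- rank–nullity for its restriction to `U`
  have hcard : Fintype.card {i : Fin s // i ≠ l} + 1 = s := by
    have h1 := Fintype.card_subtype_compl (fun i : Fin s ↦ i = l)
    rw [Fintype.card_fin, Fintype.card_subtype_eq] at h1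
    have h2 : 1 ≤ s := Nat.succ_le_of_lt (Nat.pos_of_ne_zero fun h ↦ by subst h; exact l.elim0)
    change Fintype.card {i : Fin s // ¬ i = l} + 1 = s
    omega
  have hrange : Module.finrank (ZMod 2) (LinearMap.range (φ.comp U.subtype)) + 1 ≤ s := by
    have h := Submodule.finrank_le (LinearMap.range (φ.comp U.subtype))
    rw [Module.finrank_fintype_fun_eq_card] at h
    omega
  have hker : 2 ≤ Module.finrank (ZMod 2) (LinearMap.ker (φ.comp U.subtype)) := by
    have h := LinearMap.finrank_range_add_finrank_ker (φ.comp U.subtype)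
    rw [hU] at h
    omega
  -- the kernel, pushed into `QVec s`, is not inside the line through `x`
  have hWrank : 2 ≤ Module.finrank (ZMod 2) ((LinearMap.ker (φ.comp U.subtype)).map U.subtype) := by
    rw [Submodule.finrank_map_subtype_eq]
    exact hker
  have hnot : ¬ ((LinearMap.ker (φ.comp U.subtype)).map U.subtype ≤ Submodule.span (ZMod 2) {x}) := by
    intro hle
    have h1 : Module.finrank (ZMod 2) (Submodule.span (ZMod 2) ({x} : Set (QVec s))) ≤ 1 := by
      simpa using finrank_span_le_card ({x} : Set (QVec s))
    have h2 := Submodule.finrank_mono hle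
    omega
  obtain ⟨y, hyW, hyx⟩ := SetLike.not_le_iff_exists.mp hnot
  obtain ⟨⟨y', hy'U⟩, hy'ker, rfl⟩ := Submodule.mem_map.mp hyW
  have hφ0 : φ y' = 0 := by
    have h := LinearMap.mem_ker.mp hy'ker
    rwa [LinearMap.comp_apply, Submodule.subtype_apply] at h
  refine ⟨y', hy'U, ?_, ?_, fun i hi ↦ ?_⟩
  · intro h0
    apply hyx
    change y' ∈ Submodule.span (ZMod 2) ({x} : Set (QVec s))
    rw [h0]
    exact Submodule.zero_mem _
  · intro hx'
    apply hyx
    change y' ∈ Submodule.span (ZMod 2) ({x} : Set (QVec s))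
    rw [hx']
    exact Submodule.mem_span_singleton_self x
  · have hi' : φ y' ⟨i, hi⟩ = 0 := by rw [hφ0, Pi.zero_apply]
    rw [hφ] at hi'
    refine ⟨fun hin ↦ ?_, fun hin ↦ ?_⟩
    · simpa [hin] using hi'
    · simpa [hin] using hi'

/-! ### §4 Main lemma: adjacent core vertices have no common generator -/

/-- The `𝔽₂²` bookkeeping of the anisotropic case: if `a ≠ 0` is singular, `b` satisfies
`b.1·b.2 + 1 = 0` (so `b = w + w′`), then `(a + b).1·(a + b).2 + 1 ≠ 0`. [folklore] -/
theorem anisotropic_bookkeeping :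
    ∀ a b : ZMod 2 × ZMod 2, a ≠ 0 → a.1 * a.2 = 0 → b.1 * b.2 + 1 = 0 →
      (a + b).1 * (a + b).2 + 1 = 0 → False := by
  decide

/-- Every vector of `𝔽₂²` is one of `0`, `w`, `w′`, `w + w′`. [folklore] -/
theorem zmod2_sq_cases : ∀ a : ZMod 2 × ZMod 2, a = (0, 0) ∨ a = (1, 0) ∨ a = (0, 1) ∨ a = (1, 1) := by
  decide

/-- **MAIN LEMMA (no common generator).** Let `U` be a totally singular Lagrangian, `ℓ ∉ n`, and let
`n` and `n ∪ {ℓ}` both be core. Then `U ∩ Λ_n ∩ Λ_{n ∪ ℓ} = 0`: a vector `x` there has `x_ℓ = 0`, and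
a second vector `y ∈ U`, `y ∉ {0, x}`, with the `Λ_n`-conditions off `ℓ` (§3) is absurd in each of the
four cases for `y_ℓ`: `(0,0)` or `(1,0)` ⇒ `y ∈ Λ_n` ⇒ `y = x` (§2); `(0,1)` ⇒ `y ∈ Λ_{n∪ℓ}` ⇒ `y = x`;
`(1,1)` ⇒ `q(y) = 0` forces `y_∞ = w + w′` and then `q(x + y) = 1`. (lens-2 G5.3 T2, "directly via
`dim P̄₂ = 2`".) [cite: MazurRubin2004Intro, §5] -/
theorem eq_zero_of_inLam_of_inLam_insert {U : Submodule (ZMod 2) (QVec s)} (hU : IsTSLagrangian U)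
    {n : Finset (Fin s)} {l : Fin s} (hl : l ∉ n) (hn : CoreQ U n) (hnl : CoreQ U (insert l n))
    {x : QVec s} (hx : x ∈ U) (hxn : InLam n x) (hxnl : InLam (insert l n) x) : x = 0 := by
  by_contra hx0
  obtain ⟨y, hyU, hy0, hyx, hy⟩ := exists_relaxed hU.2 n l x
  have hxl1 : (x (some l)).1 = 0 := (hxnl l).1 (mem_insert_self l n)
  have hxl2 : (x (some l)).2 = 0 := (hxn l).2 hl
  have hx1 : x none ≠ 0 := apply_none_ne_zero hn hx hxn hx0
  have hqx : (x none).1 * (x none).2 = 0 := by rw [← qform_eq_of_inLam hxn]; exact hU.1 x hx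
  rcases zmod2_sq_cases (y (some l)) with h | h | h | h
  · -- `y_ℓ = 0`: `y ∈ Λ_n`, so `y = x`
    have hyn : InLam n y := inLam_of_relaxed hl hy (by rw [h])
    exact hyx (eq_of_inLam hU.1 hn hyU hx hyn hxn hy0 hx0)
  · -- `y_ℓ = u_ℓ`: `y ∈ Λ_n`, so `y = x`, but `x_ℓ.1 = 0`
    have hyn : InLam n y := inLam_of_relaxed hl hy (by rw [h])
    have hyx' : y = x := eq_of_inLam hU.1 hn hyU hx hyn hxn hy0 hx0
    rw [hyx'] at h
    rw [h] at hxl1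
    exact one_ne_zero hxl1
  · -- `y_ℓ = t_ℓ`: `y ∈ Λ_{n ∪ ℓ}`, so `y = x`, but `x_ℓ.2 = 0`
    have hynl : InLam (insert l n) y := inLam_insert_of_relaxed hy (by rw [h])
    have hyx' : y = x := eq_of_inLam hU.1 hnl hyU hx hynl hxnl hy0 hx0
    rw [hyx'] at h
    rw [h] at hxl2
    exact one_ne_zero hxl2
  · -- `y_ℓ = u_ℓ + t_ℓ`: `q(y) = 0` forces `y_∞ = w + w′`, and then `q(x + y) = 1`
    have hqy : (y none).1 * (y none).2 + 1 = 0 := by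
      have := hU.1 y hyU
      rw [qform_eq_of_relaxed hy, h, mul_one] at this
      exact this
    have hxy : ∀ i : Fin s, i ≠ l →
        (i ∈ n → ((x + y) (some i)).1 = 0) ∧ (i ∉ n → ((x + y) (some i)).2 = 0) := fun i hi ↦
      ⟨fun hin ↦ by rw [Pi.add_apply, Prod.fst_add, (hxn i).1 hin, (hy i hi).1 hin, add_zero],
       fun hin ↦ by rw [Pi.add_apply, Prod.snd_add, (hxn i).2 hin, (hy i hi).2 hin, add_zero]⟩
    have hqxy : ((x + y) none).1 * ((x + y) none).2 + 1 = 0 := by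
      have := hU.1 (x + y) (U.add_mem hx hyU)
      rw [qform_eq_of_relaxed hxy] at this
      have hl' : (x + y) (some l) = (1, 1) := by
        rw [Pi.add_apply, h, Prod.ext_iff]
        simp [hxl1, hxl2]
      rw [hl', mul_one] at this
      exact this
    exact anisotropic_bookkeeping (x none) (y none) hx1 hqx hqy (by simpa using hqxy)

end Cube

/-! ### §5 QS4 and QS4′ -/

/-- **QS4 (INDUCED CUBE, T2), proved** — Q1's word-shape `InducedCube` verbatim: if `n` and `n ∪ {ℓ}`
(`ℓ ∉ n`) are both core for the totally singular Lagrangian `U`, the generator `c_n` of `U ∩ Λ_n` has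
`u_ℓ`-coordinate `1` (were it `0`, `c_n` would lie in `Λ_{n ∪ ℓ}` as well, contradicting
`Cube.eq_zero_of_inLam_of_inLam_insert`). Cube-adjacent core vertices are `𝒳⁰`-adjacent:
`loc_ℓ c_n ≠ 0`. (lens-2 G5.3 T2; exec 768 / 768 at |D| = 3.) [cite: MazurRubin2004Intro, §5] -/
theorem inducedCube_holds : InducedCube := by
  intro s U n l x hU hl hn hnl hx hxn hx0
  have h01 : ∀ a : ZMod 2, a = 0 ∨ a = 1 := by decide
  rcases h01 ((x (some l)).1) with h | h
  · exact absurd (Cube.eq_zero_of_inLam_of_inLam_insert hU hl hn hnl hx hxn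
      (Cube.inLam_insert_of_inLam l hxn h)) hx0
  · exact h

/-- **QS4′ (INDUCED CUBE, second half), proved** — Q1's word-shape `InducedCube'` verbatim: under the
same hypotheses the generator `c_{n ∪ ℓ}` of `U ∩ Λ_{n ∪ ℓ}` has `t_ℓ`-coordinate `1` (were it `0`,
`c_{n ∪ ℓ}` would lie in `Λ_n` as well). This is the other isomorphism in Mazur–Rubin's definition of
an `𝒳⁰`-edge. (exec 768 / 768 at |D| = 3.) [cite: MazurRubin2004Intro, §5] -/
theorem inducedCube'_holds : InducedCube' := by
  intro s U n l x hU hl hn hnl hx hxnl hx0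
  have h01 : ∀ a : ZMod 2, a = 0 ∨ a = 1 := by decide
  rcases h01 ((x (some l)).2) with h | h
  · exact absurd (Cube.eq_zero_of_inLam_of_inLam_insert hU hl hn hnl hx
      (Cube.inLam_of_inLam_insert hl hxnl h) hxnl) hx0
  · exact h

end Summit.BirchSwinnertonDyer.Rank1Residual.X5.SelmerSolitaire.Quadratic
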